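import Mathlib
import HarnessLib
import Summits.ValiantsHypothesis.ValiantsHypothesis.Theorems.LacunarySymmetroidMatrixDescartesOsculationLawRankLetterRealRoots

/-!
# ValiantsHypothesis / LacunarySymmetroid — crux `MatrixDescartes` (stmt-ValiantsHypothesis-18050, V1),
# line `Cruxes/MatrixDescartes/Lines/osculation_law.lean` («osculation-law»), stub `stub_peel` (ALL ranks):
# THE VERTICAL FAMILY OF A SYMMETRIC BLOCK PENCIL (the (δ)-glue of NOTE-p7g12-peel-general-r-sizing.md §6)

Every rank-free `…OsculationLawPeel*` theorem is stated for an abstract spectral curve `Φ : MvPolynomial (Fin 2) ℝ`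
presented through a vertical family `P : ℝ → ℝ[X]` with `hP : (P t)(b) = Φ(t, b)` and hyperbolicity
`hsplit : ∀ t > 0, (P t).Splits`.  This file supplies `P`, `hP`, `hsplit` (and the identification of the constant coefficient
with `blockDet`) for the pencils of the line: `Φ = det(Σ_l X₀^{d l}·S_l + X₁·(I_r ⊕ 0))`, `S_l` real symmetric on `Fin r ⊕ Fin s`,
with `P t := det(C(G(t)) + X·C(I_r ⊕ 0))`, `G(t) = Σ_l t^{d l} S_l` — real-rooted at EVERY rank and every degeneracy by p5 g11's
`OsculationLetter.splits_det_add_X_smul_blockProj`.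

* `pencilAt_isSymm` — `G(t)` is symmetric.
* **`eval_pencil_letter`** — `hP`: `(P t).eval b = MvPolynomial.eval ![t, b] Φ`.
* **`splits_pencil_letter`** — `hsplit` (for every real `t`).
* `coeff_zero_pencil_letter`, `eval_blockDet` — `(P t).coeff 0 = det G(t) = blockDet(t)`;
  `eval_lowerDet` — `lowerDet(t) = det G(t)₂₂`.

Honest framing: glue LEMMAS toward the OPEN stub `stub_peel` (all `r`); nothing of the summit is proved; `VP ≠ VNP` is NOT
proved.  No definitions, no named facts.
-/

-- `Summit.ValiantsHypothesis.ValiantsHypothesis.…` is the tree's mandated single-conjunct layout (Sub = Summit).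
set_option linter.dupNamespace false

noncomputable section

namespace Summit.ValiantsHypothesis.ValiantsHypothesis.Theorems.LacunarySymmetroidMatrixDescartes

open Polynomial
open scoped BigOperators

namespace OsculationPeel

variable {r s K : ℕ} (d : Fin K → ℕ) (S : Fin K → Matrix (Fin r ⊕ Fin s) (Fin r ⊕ Fin s) ℝ)

/-- `G(t) = Σ_l t^{d l} S_l` is symmetric when the `S_l` are. [folklore] -/
theorem pencilAt_isSymm (hS : ∀ l, (S l).IsSymm) (t : ℝ) : (∑ l, t ^ d l • S l).IsSymm := by
  refine Matrix.IsSymm.ext fun i j => ?_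
  simp only [Matrix.sum_apply, Matrix.smul_apply, smul_eq_mul]
  exact Finset.sum_congr rfl fun l _ => by rw [(hS l).apply i j]

/-- **`hP` for pencils**: the letter of `G(t)` evaluated at `b` is the spectral curve at `(t, b)`. [folklore] -/
theorem eval_pencil_letter (t b : ℝ) :
    (Matrix.det ((∑ l, t ^ d l • S l).map Polynomial.C
      + (X : ℝ[X]) • (Matrix.fromBlocks 1 0 0 0 : Matrix (Fin r ⊕ Fin s) (Fin r ⊕ Fin s) ℝ).map Polynomial.C)).eval b =
    MvPolynomial.eval ![t, b]
      (∑ l, (MvPolynomial.X (0 : Fin 2) : MvPolynomial (Fin 2) ℝ) ^ d l •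
              (S l).map (MvPolynomial.C : ℝ →+* MvPolynomial (Fin 2) ℝ)
            + (MvPolynomial.X (1 : Fin 2) : MvPolynomial (Fin 2) ℝ) •
              (Matrix.fromBlocks 1 0 0 0 : Matrix (Fin r ⊕ Fin s) (Fin r ⊕ Fin s) ℝ).map
                (MvPolynomial.C : ℝ →+* MvPolynomial (Fin 2) ℝ)).det := by
  rw [OsculationLetter.eval_det_letter, RingHom.map_det, RingHom.mapMatrix_apply]
  congr 1
  ext i j
  simp only [Matrix.add_apply, Matrix.smul_apply, Matrix.sum_apply, Matrix.map_apply, smul_eq_mul, map_add, map_sum,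
    map_mul, map_pow, MvPolynomial.eval_X, MvPolynomial.eval_C, Matrix.cons_val_zero, Matrix.cons_val_one]

/-- **`hsplit` for pencils**: the letter of `G(t)` is real-rooted (every rank, every degeneracy). [folklore] -/
theorem splits_pencil_letter (hS : ∀ l, (S l).IsSymm) (t : ℝ) :
    (Matrix.det ((∑ l, t ^ d l • S l).map Polynomial.C
      + (X : ℝ[X]) • (Matrix.fromBlocks 1 0 0 0 : Matrix (Fin r ⊕ Fin s) (Fin r ⊕ Fin s) ℝ).map Polynomial.C)).Splits :=
  OsculationLetter.splits_det_add_X_smul_blockProj r s _ (pencilAt_isSymm d S hS t)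

/-- The constant coefficient of the letter of `G(t)` is `det G(t)`. [folklore] -/
theorem coeff_zero_pencil_letter (t : ℝ) :
    (Matrix.det ((∑ l, t ^ d l • S l).map Polynomial.C
      + (X : ℝ[X]) • (Matrix.fromBlocks 1 0 0 0 : Matrix (Fin r ⊕ Fin s) (Fin r ⊕ Fin s) ℝ).map Polynomial.C)).coeff 0 =
    (∑ l, t ^ d l • S l).det := by
  rw [Polynomial.coeff_zero_eq_eval_zero, OsculationLetter.eval_det_letter, zero_smul, add_zero]

/-- `blockDet(t) = det G(t)`: evaluating the determinant of the polynomial pencil. [folklore] -/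
theorem eval_blockDet (t : ℝ) :
    ((∑ l, (X : ℝ[X]) ^ d l • (S l).map Polynomial.C).det).eval t = (∑ l, t ^ d l • S l).det := by
  rw [← Polynomial.coe_evalRingHom, RingHom.map_det, RingHom.mapMatrix_apply]
  congr 1
  ext i j
  simp only [Matrix.map_apply, Matrix.sum_apply, Matrix.smul_apply, smul_eq_mul, Polynomial.coe_evalRingHom, eval_finsetSum,
    eval_mul, eval_pow, eval_X, eval_C]

/-- `lowerDet(t) = det G(t)₂₂`. [folklore] -/
theorem eval_lowerDet (t : ℝ) :
    ((∑ l, (X : ℝ[X]) ^ d l • ((S l).toBlocks₂₂).map Polynomial.C).det).eval t = (∑ l, t ^ d l • S l).toBlocks₂₂.det := by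
  rw [← Polynomial.coe_evalRingHom, RingHom.map_det, RingHom.mapMatrix_apply]
  congr 1
  ext i j
  simp only [Matrix.map_apply, Matrix.sum_apply, Matrix.smul_apply, smul_eq_mul, Polynomial.coe_evalRingHom, eval_finsetSum,
    eval_mul, eval_pow, eval_X, eval_C, Matrix.toBlocks₂₂, Matrix.of_apply]

/-- **ZERO ends are zeros of `blockDet`**: `Φ(ω, 0) = 0 ⇔`-direction used by the peel: if the curve passes through `(ω, 0)`
then `blockDet(ω) = 0`. [folklore] -/
theorem blockDet_eval_eq_zero_of_curve {ω : ℝ}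
    (h : MvPolynomial.eval ![ω, 0]
      (∑ l, (MvPolynomial.X (0 : Fin 2) : MvPolynomial (Fin 2) ℝ) ^ d l •
              (S l).map (MvPolynomial.C : ℝ →+* MvPolynomial (Fin 2) ℝ)
            + (MvPolynomial.X (1 : Fin 2) : MvPolynomial (Fin 2) ℝ) •
              (Matrix.fromBlocks 1 0 0 0 : Matrix (Fin r ⊕ Fin s) (Fin r ⊕ Fin s) ℝ).map
                (MvPolynomial.C : ℝ →+* MvPolynomial (Fin 2) ℝ)).det = 0) :
    ((∑ l, (X : ℝ[X]) ^ d l • (S l).map Polynomial.C).det).eval ω = 0 := by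
  rw [eval_blockDet, ← coeff_zero_pencil_letter d S ω, Polynomial.coeff_zero_eq_eval_zero, eval_pencil_letter, h]

end OsculationPeel

end Summit.ValiantsHypothesis.ValiantsHypothesis.Theorems.LacunarySymmetroidMatrixDescartes

end
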